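import Literature.AnabelianGeometry.SemiGraphs.QuasiTemperoidsThmA4Torsor
import Literature.AnabelianGeometry.SemiGraphs.QuasiTemperoidsThmA4ExistsChart
import Literature.AnabelianGeometry.SemiGraphs.QuasiTemperoidsHomResRel
import HarnessLib

/-!
# Semi-graphs of anabelioids, Appendix: Theorem A.4 — existence half for Galois-countable charts

Mochizuki, *Semi-graphs of anabelioids*, Publ. RIMS **42** (2006), Appendix, Theorem A.4 (manuscript
pp. 82–86) [cite: MochizukiSemiAnbd2006, Thm A.4 pp.82-86].  PROOF-ONLY final glue of the chart route
(L3-lead μ3-1/ν3-1; rows C-S1a abc-iut-w5-d106, C-S1b abc-iut-w5-d220, C-S1c abc-iut-w5-d216, C-S2/S3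
abc-iut-w5-d106): the engine conclusion `exists_res_iso` — for `Π₂` tempered and SECOND COUNTABLE, every
functor `F : T₂[A₂] ⥤ T₁[A₁]` between the model quasi-temperoids `B^temp(Πᵢ)[Aᵢ]` preserving finite
limits, countable colimits and nondegenerate objects satisfies `F ⋙ ι₁ ≅ ι₂ ⋙ B^temp(f)` for a continuous
`f : Π₁ → Π₂` (`BTemp.exists_hom_natIso_res_of_torsor`, the composite of abc-iut-w5-d220's
`exists_continuousMonoidHom_of_fullSubcategory` and abc-iut-w5-d216's `exists_natIso_res_of_torsorData`,
`QuasiTemperoidsHomResRel.lean` p416047, fed with the torsor facts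
`ThmA4Chart.fibreQ_transitive / fibreQ_coe_eq_of_rightMul_eq / map_orbitMap`) — and hence Thm. A.4 for
connected temperoids admitting Galois-countable charts: `thmA4_exists_of_secondCountable`,
`thmA4_of_secondCountable` (through `thmA4_exists_of_engine` / `thmA4_unique`).  HONEST FRAMING: this
is the RESTRICTED theorem ([IUTchI] Rmk. 2.5.3 (ii) (E7): Galois-countable tempered groups); it does NOT
close the typed `ThmA4` (FACT-LIST F-1634), which carries no countability hypothesis and whose printed
proof (QD-pairs, pp. 83–86) is route «A4-q…A4-T» of plan/L3/SUBDAG-SemiAnbd-Cor311.md.  Nothing here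
takes a side on [IUTchIII] Cor. 3.12.
-/

namespace Literature.AnabelianGeometry.SemiGraphs

namespace ThmA4Chart

open CategoryTheory CategoryTheory.Limits Topology
open Literature.AlgebraicGeometry.Frobenioids (IsConnectedObj IsNonemptyObj)

universe v₁ v₂ u u₁ u₂

/-! ### The engine conclusion -/

section Engine

variable {G₁ : Type u} [Group G₁] [TopologicalSpace G₁] [IsTopologicalGroup G₁]
  {G₂ : Type u} [Group G₂] [TopologicalSpace G₂] [IsTopologicalGroup G₂] [SecondCountableTopology G₂]
  (hG₂ : IsTempered G₂) {A₁ : BTemp G₁} (hA₁ : IsConnectedObj A₁) {A₂ : BTemp G₂} (a₂ : A₂.obj.V)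
  (F : Over' A₂ ⥤ Over' A₁) (hlim : PreservesFiniteLimits F)
  (hcolim : ∀ (J : Type) [SmallCategory J] [CountableCategory J], PreservesColimitsOfShape J F)
  (hnd : ∀ X : Over' A₂, IsNondegenerateObj X → IsNondegenerateObj (F.obj X))

include hG₂ hA₁ a₂ hlim hcolim hnd in
/-- **The chart-route engine, assembled** (Galois-countable `Π₂`): `F ⋙ ι₁ ≅ ι₂ ⋙ B^temp(f)` for some
continuous `f : Π₁ → Π₂` — `BTemp.exists_hom_natIso_res_of_torsor` (the port of the Prop. 3.2 engine
to the full subcategory `T₂[A₂]`, abc-iut-w5-d220/d216) at `P := admitsHomTo A₂`,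
`M₀ :=` an open normal subgroup inside `Stab(a₂)`, with the torsor facts of `QuasiTemperoidsThmA4Torsor`.
[cite: MochizukiSemiAnbd2006, Thm A.4 pp.82-86] -/
theorem exists_res_iso :
    ∃ f : G₁ →ₜ* G₂, Nonempty (F ⋙ (admitsHomTo A₁).ι ≅ (admitsHomTo A₂).ι ⋙ BTemp.res f) := by
  -- an open normal subgroup fixing the base point
  obtain ⟨N₀, -, -⟩ := hG₂.basis Set.univ Filter.univ_mem
  obtain ⟨M₀, -, hM₀⟩ := exists_le_stab hG₂ A₂ a₂ N₀
  have hle : ∀ N : OpenNormalSubgroup G₂, N ≤ M₀ → N.toSubgroup ≤ BTemp.stab A₂ a₂ :=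
    fun N hN g hg => hM₀ (hN hg)
  have hP₀ : ∀ N : OpenNormalSubgroup G₂, N ≤ M₀ → admitsHomTo A₂ (BTemp.Q hG₂ N) :=
    fun N hN => ⟨BTemp.orbitMap hG₂ A₂ a₂ N (hle N hN)⟩
  have hP : ∀ {X Y : BTemp G₂}, (X ⟶ Y) → admitsHomTo A₂ Y → admitsHomTo A₂ X :=
    fun f ⟨p⟩ => ⟨f ≫ p⟩
  have hcoprod : ∀ (ι : Type) [Countable ι],
      PreservesColimitsOfShape (Discrete ι) (F ⋙ (admitsHomTo A₁).ι) := by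
    intro ι _
    haveI : PreservesColimitsOfShape (Discrete ι) F := hcolim _
    haveI : HasColimitsOfShape (Discrete ι) (BTemp G₁) := BTemp.hasCountableCoproducts.out ι
    haveI := admitsHomTo_isClosedUnderColimitsOfShape_discrete A₁ ι
    infer_instance
  obtain ⟨f, ⟨θ⟩⟩ := BTemp.exists_hom_natIso_res_of_torsor hG₂ (admitsHomTo A₂)
    (F ⋙ (admitsHomTo A₁).ι) M₀ hP₀ hP hcoprod
    (fun N hN => fibreQ_transitive hG₂ hA₁ a₂ F hlim hcolim hnd N (hle N hN))
    (fun N hN {g g' y} h => fibreQ_coe_eq_of_rightMul_eq hG₂ a₂ F hlim hcolim N (hle N hN) h)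
    (fun N hN X x₀ htr hk₀ =>
      ⟨(map_orbitMap hG₂ a₂ F hcolim N (hle N hN) X x₀ htr hk₀).1, fun y₁ y₂ h =>
        ((map_orbitMap hG₂ a₂ F hcolim N (hle N hN) X x₀ htr hk₀).2 y₁ y₂).mp h⟩)
  exact ⟨f, ⟨θ.symm⟩⟩

end Engine

/-- The engine conclusion in the exact binder shape consumed by `thmA4_exists_of_engine` (the unused
hypotheses on `Π₁` are part of that shape). [cite: MochizukiSemiAnbd2006, Thm A.4 pp.82-86] -/
theorem exists_res_iso' :
    ∀ {G₁ : Type u} [Group G₁] [TopologicalSpace G₁] [IsTopologicalGroup G₁]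
      [SecondCountableTopology G₁]
      {G₂ : Type u} [Group G₂] [TopologicalSpace G₂] [IsTopologicalGroup G₂]
      [SecondCountableTopology G₂] (_ : IsTempered G₁) (_ : IsTempered G₂)
      {A₁ : BTemp G₁} (_ : IsConnectedObj A₁) {A₂ : BTemp G₂} (_ : A₂.obj.V)
      (F : Over' A₂ ⥤ Over' A₁) (_ : PreservesFiniteLimits F)
      (_ : ∀ (J : Type) [SmallCategory J] [CountableCategory J], PreservesColimitsOfShape J F)
      (_ : ∀ X : Over' A₂, IsNondegenerateObj X → IsNondegenerateObj (F.obj X)),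
      ∃ φ : G₁ →ₜ* G₂, Nonempty (F ⋙ (admitsHomTo A₁).ι ≅ (admitsHomTo A₂).ι ⋙ BTemp.res φ) := by
  intro G₁ _ _ _ _ G₂ _ _ _ _ _ hG₂ A₁ hA₁ A₂ a₂ F hlim hcolim hnd
  exact exists_res_iso hG₂ hA₁ a₂ F hlim hcolim hnd

/-! ### Theorem A.4 for Galois-countable charts -/

/-- **[SemiAnbd] Thm. A.4, EXISTENCE half, for connected temperoids with Galois-countable charts**:
every morphism of connected quasi-temperoids `φ : T₁[A₁] → T₂[A₂]` (Def. A.1 (iii): `φ^*` preserves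
finite limits, countable colimits and nondegenerate objects) is the restriction of a morphism of
temperoids `ψ : T₁ → T₂` — `φ^* ⋙ λ₁^* ≅ λ₂^* ⋙ ψ^*` — provided `Tᵢ ≌ B^temp(Πᵢ)` with `Πᵢ` second
countable. [cite: MochizukiSemiAnbd2006, Thm A.4 pp.82-86] -/
theorem thmA4_exists_of_secondCountable {T₁ : Type u₁} [Category.{v₁} T₁] {T₂ : Type u₂}
    [Category.{v₂} T₂] (c₁ : ConnectedTemperoidChart.{v₁, u, u₁} T₁)
    (c₂ : ConnectedTemperoidChart.{v₂, u, u₂} T₂) [SecondCountableTopology c₁.G]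
    [SecondCountableTopology c₂.G] {A₁ : T₁} {A₂ : T₂} (hA₁ : IsConnectedObj A₁)
    (hA₂ : IsConnectedObj A₂) (φ : TemperoidHom (Over' A₁) (Over' A₂))
    (hφ : φ.PreservesNondegenerate) :
    ∃ ψ : TemperoidHom T₁ T₂,
      Nonempty (φ.pullback ⋙ (admitsHomTo A₁).ι ≅ (admitsHomTo A₂).ι ⋙ ψ.pullback) :=
  thmA4_exists_of_engine @exists_res_iso' c₁ c₂ hA₁ hA₂ φ hφ

/-- **[SemiAnbd] Thm. A.4 for connected temperoids with Galois-countable charts** — the `ThmA4`-shaped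
statement (existence of `(ψ, α)` AND uniqueness of `β`) under the hypothesis that `Tᵢ ≌ B^temp(Πᵢ)` with
`Πᵢ` second countable ([IUTchI] Rmk. 2.5.3 (ii) (E7): Galois-countable). The typed `ThmA4`
(QuasiTemperoidsQDPairs l.315) has no such hypothesis and is NOT closed by this theorem.
[cite: MochizukiSemiAnbd2006, Thm A.4 pp.82-86] -/
theorem thmA4_of_secondCountable {T₁ : Type u₁} [Category.{v₁} T₁] {T₂ : Type u₂}
    [Category.{v₂} T₂] (c₁ : ConnectedTemperoidChart.{v₁, u, u₁} T₁)
    (c₂ : ConnectedTemperoidChart.{v₂, u, u₂} T₂) [SecondCountableTopology c₁.G]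
    [SecondCountableTopology c₂.G] {A₁ : T₁} {A₂ : T₂} (hA₁ : IsConnectedObj A₁)
    (hA₂ : IsConnectedObj A₂) (φ : TemperoidHom (Over' A₁) (Over' A₂))
    (hφ : φ.PreservesNondegenerate) :
    ∃ (ψ : TemperoidHom T₁ T₂)
      (α : φ.pullback ⋙ (admitsHomTo A₁).ι ≅ (admitsHomTo A₂).ι ⋙ ψ.pullback),
      ∀ (ψ' : TemperoidHom T₁ T₂)
        (α' : φ.pullback ⋙ (admitsHomTo A₁).ι ≅ (admitsHomTo A₂).ι ⋙ ψ'.pullback),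
        ∃! β : ψ.pullback ≅ ψ'.pullback, α ≪≫ (admitsHomTo A₂).ι.isoWhiskerLeft β = α' :=
  thmA4_of_engine @exists_res_iso' c₁ c₂ hA₁ hA₂ φ hφ

end ThmA4Chart

end Literature.AnabelianGeometry.SemiGraphs
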